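import Summits.Ventures.Crystal3D.Theorems.StickyWulffConstantCoaxialWallLawTerracePropagation
import HarnessLib

/-!
# The flux gap of a co-axial pair: a steep up-slot on one side, a shallow one on the other

HONEST FRAMING. Part of the venture `Summits/Ventures/Crystal3D` (cell `crystal3d-full`), helper for the
crux `CoaxialWallLaw` (stmt-Ventures-19481) of `route-Ventures-StickyWulffConstant`, REGISTERED line
`WallLedgerF` (planner cf-p1 gen 16), open stub `stub_coaxialTwoSlabAdhesion` (general fillings).  First
brick of the FLUX-GAP (beam-expansion) architecture for general fillings of the co-axial cell (memo
F-FLUXGAP-ARCH on the item): pure slot trigonometry.  Rung credit only; F-C1 not moved.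

SETTING.  A grain frame `A`, a unit axis `m` in menu position (`⟪A w, m⟫ ∈ {0, ±√(2/3)}` for the twelve
slots), the three FAR slots `u₁, u₂, u₃` of `(A, m)` (`exists_far_frame`: `⟪A uᵢ, m⟫ = √(2/3)`, pairwise
`⟪uᵢ, uⱼ⟫ = ½`), and a unit «vertical» `z`.  Write `c = ⟪m, z⟫` and `δᵢ = ⟪A uᵢ, z⟫ − √(2/3)·c` for the
deviation of the vertical component of the far slot `A uᵢ` from its mean.

* `linearIndependent_of_orthogonal_three` — three pairwise orthogonal non-zero vectors of `ℝ³` are independent.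
* `sum_far_inner` — `⟪A u₁, z⟫ + ⟪A u₂, z⟫ + ⟪A u₃, z⟫ = √6 ⟪m, z⟫`, i.e. `δ₁ + δ₂ + δ₃ = 0`
  (`sum_eq_sqrt_six_smul`).
* `far_deviation_identity` — **`3 δ₁² + (δ₂ − δ₃)² = 1 − c²`**: with `p₁ = A u₁ − √(2/3) m` and `q = A u₂ − A u₃`,
  the triple `(p₁, q, m)` is orthogonal with `‖p₁‖² = ⅓`, `‖q‖ = ‖m‖ = 1`, so `x = z − c m` decomposes as
  `3⟪x, p₁⟫ p₁ + ⟪x, q⟫ q` and `‖x‖² = 1 − c²`.  Hence `Σ δᵢ² = (1 − c²)/2`.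
* `exists_far_slot_steep` — **some far slot is steep by `s/(2√3)`**: there is `i` with
  `√(1 − c²) ≤ 2√3 · δᵢ` (three reals with sum `0` and sum of squares `(1 − c²)/2` have maximum `≥ √((1−c²)/12)`).
* `exists_far_slots_spread` — **two far slots differ by `(√3/2) s`**: there are `i, j` with
  `√3 · √(1 − c²) ≤ 2 (δᵢ − δⱼ)` (the spread `D` of three such reals has `D² ≥ ¾ (1 − c²)`).

USE (memo §0): with `m = L e₃` the common axis of a co-axial pair and `z = e₃`, `√(1 − c²) = sin θ` is the
stub's `√(1 − ⟪L e₃, e₃⟫²)`; the slot lines of grain 1 along the steep far slot carry the flux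
`√2 (√(2/3) c + δ_max) π ρ²`, while after a coherent twin step the continuation along the mirror slot
`2√(2/3) m − A u` has vertical component `√(2/3) c − δ`, so at most `√2 (√(2/3) c − δ_max) π ρ² + O(ρ)` lines
can enter the top window: the FLUX GAP is `≥ 2√2 δ_max π ρ² ≥ √(2/3) sin θ · π ρ²` (twin pairs) and
`≥ √2 (δ_max − δ_min) π ρ² ≥ √(3/2) sin θ · π ρ²` (translation pairs).

WHAT THIS IS NOT: no packing appears here; not the stub; F-C1 not moved.
-/

noncomputable section

namespace Summit.Ventures.Crystal3D.Theorems

open Summit.Ventures.Crystal3D Finset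
open Literature.MathematicalPhysics.StatisticalMechanics (fccStacking)
open scoped InnerProductSpace

/-! ### Linear algebra -/

/-- Three pairwise orthogonal non-zero vectors of `ℝ³` are linearly independent. -/
theorem linearIndependent_of_orthogonal_three {a b c : EuclideanSpace ℝ (Fin 3)}
    (ha : a ≠ 0) (hb : b ≠ 0) (hc : c ≠ 0)
    (hab : ⟪a, b⟫_ℝ = 0) (hac : ⟪a, c⟫_ℝ = 0) (hbc : ⟪b, c⟫_ℝ = 0) :
    LinearIndependent ℝ ![a, b, c] := by
  have na : 0 < ⟪a, a⟫_ℝ := real_inner_self_pos.2 ha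
  have nb : 0 < ⟪b, b⟫_ℝ := real_inner_self_pos.2 hb
  have nc : 0 < ⟪c, c⟫_ℝ := real_inner_self_pos.2 hc
  have hba : ⟪b, a⟫_ℝ = 0 := by rw [real_inner_comm]; exact hab
  have hca : ⟪c, a⟫_ℝ = 0 := by rw [real_inner_comm]; exact hac
  have hcb : ⟪c, b⟫_ℝ = 0 := by rw [real_inner_comm]; exact hbc
  rw [Fintype.linearIndependent_iff]
  intro g hg
  simp only [Fin.sum_univ_three, Matrix.cons_val_zero, Matrix.cons_val_one, Matrix.cons_val] at hg
  have e0 := congrArg (fun v => ⟪v, a⟫_ℝ) hg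
  have e1 := congrArg (fun v => ⟪v, b⟫_ℝ) hg
  have e2 := congrArg (fun v => ⟪v, c⟫_ℝ) hg
  simp only [inner_add_left, real_inner_smul_left, inner_zero_left, hab, hac, hbc, hba, hca, hcb,
    mul_zero, add_zero, zero_add] at e0 e1 e2
  intro i
  fin_cases i
  · show g 0 = 0; exact (mul_eq_zero.1 e0).resolve_right na.ne'
  · show g 1 = 0; exact (mul_eq_zero.1 e1).resolve_right nb.ne'
  · show g 2 = 0; exact (mul_eq_zero.1 e2).resolve_right nc.ne'

/-! ### The three far slots against a vertical -/

section FarFrame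

variable (A : EuclideanSpace ℝ (Fin 3) ≃ₗᵢ[ℝ] EuclideanSpace ℝ (Fin 3)) {m z u₁ u₂ u₃ : EuclideanSpace ℝ (Fin 3)}

/-- **Sum of the vertical components of the far slots.**  `⟪A u₁, z⟫ + ⟪A u₂, z⟫ + ⟪A u₃, z⟫ = √6 ⟪m, z⟫`. -/
theorem sum_far_inner (hm : ‖m‖ = 1)
    (hu₁ : u₁ ∈ fccSlots) (hu₂ : u₂ ∈ fccSlots) (hu₃ : u₃ ∈ fccSlots)
    (hn₁ : ⟪A u₁, m⟫_ℝ = Real.sqrt (2 / 3)) (hn₂ : ⟪A u₂, m⟫_ℝ = Real.sqrt (2 / 3))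
    (hn₃ : ⟪A u₃, m⟫_ℝ = Real.sqrt (2 / 3))
    (i12 : ⟪u₁, u₂⟫_ℝ = 1 / 2) (i13 : ⟪u₁, u₃⟫_ℝ = 1 / 2) (i23 : ⟪u₂, u₃⟫_ℝ = 1 / 2) (z : EuclideanSpace ℝ (Fin 3)) :
    ⟪A u₁, z⟫_ℝ + ⟪A u₂, z⟫_ℝ + ⟪A u₃, z⟫_ℝ = Real.sqrt 6 * ⟪m, z⟫_ℝ := by
  have h1 := norm_eq_one_of_mem_fccSlots hu₁
  have h2 := norm_eq_one_of_mem_fccSlots hu₂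
  have h3 := norm_eq_one_of_mem_fccSlots hu₃
  have hsum := sum_eq_sqrt_six_smul (A u₁) (A u₂) (A u₃) m
    (by rw [LinearIsometryEquiv.norm_map, h1]) (by rw [LinearIsometryEquiv.norm_map, h2])
    (by rw [LinearIsometryEquiv.norm_map, h3]) hm
    (by rw [LinearIsometryEquiv.inner_map_map, i12]) (by rw [LinearIsometryEquiv.inner_map_map, i13])
    (by rw [LinearIsometryEquiv.inner_map_map, i23]) hn₁ hn₂ hn₃
  rw [← inner_add_left, ← inner_add_left, hsum, real_inner_smul_left]

/-- **The far-deviation identity** `3 δ₁² + (δ₂ − δ₃)² = 1 − ⟪m, z⟫²` for a unit `z`, where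
`δᵢ = ⟪A uᵢ, z⟫ − √(2/3) ⟪m, z⟫`.  (By symmetry the same holds for every index in the rôle of `1`.) -/
theorem far_deviation_identity (hm : ‖m‖ = 1) (hz : ‖z‖ = 1)
    (hu₁ : u₁ ∈ fccSlots) (hu₂ : u₂ ∈ fccSlots) (hu₃ : u₃ ∈ fccSlots)
    (hn₁ : ⟪A u₁, m⟫_ℝ = Real.sqrt (2 / 3)) (hn₂ : ⟪A u₂, m⟫_ℝ = Real.sqrt (2 / 3))
    (hn₃ : ⟪A u₃, m⟫_ℝ = Real.sqrt (2 / 3))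
    (i12 : ⟪u₁, u₂⟫_ℝ = 1 / 2) (i13 : ⟪u₁, u₃⟫_ℝ = 1 / 2) (i23 : ⟪u₂, u₃⟫_ℝ = 1 / 2) :
    3 * (⟪A u₁, z⟫_ℝ - Real.sqrt (2 / 3) * ⟪m, z⟫_ℝ) ^ 2 + (⟪A u₂, z⟫_ℝ - ⟪A u₃, z⟫_ℝ) ^ 2 =
      1 - ⟪m, z⟫_ℝ ^ 2 := by
  have h23 : Real.sqrt (2 / 3) ^ 2 = 2 / 3 := Real.sq_sqrt (by norm_num)
  set r := Real.sqrt (2 / 3) with hr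
  have h1 := norm_eq_one_of_mem_fccSlots hu₁
  have h2 := norm_eq_one_of_mem_fccSlots hu₂
  have h3 := norm_eq_one_of_mem_fccSlots hu₃
  -- Gram data
  have a11 : ⟪A u₁, A u₁⟫_ℝ = 1 := by
    rw [real_inner_self_eq_norm_sq, LinearIsometryEquiv.norm_map, h1, one_pow]
  have a22 : ⟪A u₂, A u₂⟫_ℝ = 1 := by
    rw [real_inner_self_eq_norm_sq, LinearIsometryEquiv.norm_map, h2, one_pow]
  have a33 : ⟪A u₃, A u₃⟫_ℝ = 1 := by
    rw [real_inner_self_eq_norm_sq, LinearIsometryEquiv.norm_map, h3, one_pow]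
  have a12 : ⟪A u₁, A u₂⟫_ℝ = 1 / 2 := by rw [LinearIsometryEquiv.inner_map_map, i12]
  have a13 : ⟪A u₁, A u₃⟫_ℝ = 1 / 2 := by rw [LinearIsometryEquiv.inner_map_map, i13]
  have a23 : ⟪A u₂, A u₃⟫_ℝ = 1 / 2 := by rw [LinearIsometryEquiv.inner_map_map, i23]
  have a21 : ⟪A u₂, A u₁⟫_ℝ = 1 / 2 := by rw [real_inner_comm]; exact a12
  have a31 : ⟪A u₃, A u₁⟫_ℝ = 1 / 2 := by rw [real_inner_comm]; exact a13
  have a32 : ⟪A u₃, A u₂⟫_ℝ = 1 / 2 := by rw [real_inner_comm]; exact a23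
  have mm : ⟪m, m⟫_ℝ = 1 := by rw [real_inner_self_eq_norm_sq, hm, one_pow]
  have zz : ⟪z, z⟫_ℝ = 1 := by rw [real_inner_self_eq_norm_sq, hz, one_pow]
  have m1 : ⟪m, A u₁⟫_ℝ = r := by rw [real_inner_comm]; exact hn₁
  have m2 : ⟪m, A u₂⟫_ℝ = r := by rw [real_inner_comm]; exact hn₂
  have m3 : ⟪m, A u₃⟫_ℝ = r := by rw [real_inner_comm]; exact hn₃
  -- the orthogonal frame `(p, q, m)`
  set p : EuclideanSpace ℝ (Fin 3) := A u₁ - r • m with hp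
  set q : EuclideanSpace ℝ (Fin 3) := A u₂ - A u₃ with hq
  set x : EuclideanSpace ℝ (Fin 3) := z - ⟪m, z⟫_ℝ • m with hx
  have pp : ⟪p, p⟫_ℝ = 1 / 3 := by
    simp only [hp, inner_sub_left, inner_sub_right, real_inner_smul_left, real_inner_smul_right, a11, hn₁,
      m1, mm]
    nlinarith [h23]
  have qq : ⟪q, q⟫_ℝ = 1 := by
    simp only [hq, inner_sub_left, inner_sub_right, a22, a33, a23, a32]; norm_num
  have pq : ⟪p, q⟫_ℝ = 0 := by
    simp only [hp, hq, inner_sub_left, inner_sub_right, real_inner_smul_left, a12, a13, m2, m3]; ring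
  have pm : ⟪p, m⟫_ℝ = 0 := by
    simp only [hp, inner_sub_left, real_inner_smul_left, hn₁, mm]; ring
  have qm : ⟪q, m⟫_ℝ = 0 := by
    simp only [hq, inner_sub_left, hn₂, hn₃]; ring
  have hp0 : p ≠ 0 := by
    intro h0; rw [h0, inner_zero_left] at pp; norm_num at pp
  have hq0 : q ≠ 0 := by
    intro h0; rw [h0, inner_zero_left] at qq; norm_num at qq
  have hm0 : m ≠ 0 := by
    intro h0; rw [h0, norm_zero] at hm; norm_num at hm
  have hind : LinearIndependent ℝ ![p, q, m] := linearIndependent_of_orthogonal_three hp0 hq0 hm0 pq pm qm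
  -- coordinates of `x`
  have xm : ⟪x, m⟫_ℝ = 0 := by
    rw [hx, inner_sub_left, real_inner_smul_left, mm, real_inner_comm]; ring
  have xp : ⟪x, p⟫_ℝ = ⟪A u₁, z⟫_ℝ - r * ⟪m, z⟫_ℝ := by
    rw [hx, hp, inner_sub_left, inner_sub_right, inner_sub_right, real_inner_smul_left, real_inner_smul_right,
      real_inner_smul_left, real_inner_smul_right, mm, real_inner_comm z (A u₁), m1, real_inner_comm z m]
    ring
  have xq : ⟪x, q⟫_ℝ = ⟪A u₂, z⟫_ℝ - ⟪A u₃, z⟫_ℝ := by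
    rw [hx, hq, inner_sub_left, inner_sub_right, inner_sub_right, real_inner_smul_left, real_inner_smul_left,
      real_inner_comm z (A u₂), real_inner_comm z (A u₃), m2, m3]
    ring
  -- `x = 3⟪x,p⟫ p + ⟪x,q⟫ q`: the difference is orthogonal to the frame
  have qp : ⟪q, p⟫_ℝ = 0 := by rw [real_inner_comm]; exact pq
  have mp : ⟪m, p⟫_ℝ = 0 := by rw [real_inner_comm]; exact pm
  have mq : ⟪m, q⟫_ℝ = 0 := by rw [real_inner_comm]; exact qm
  have mx : ⟪m, x⟫_ℝ = 0 := by rw [real_inner_comm]; exact xm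
  set y : EuclideanSpace ℝ (Fin 3) := x - (3 * ⟪x, p⟫_ℝ) • p - ⟪x, q⟫_ℝ • q with hy
  have yp : ⟪p, y⟫_ℝ = 0 := by
    rw [hy, inner_sub_right, inner_sub_right, real_inner_smul_right, real_inner_smul_right, pp, pq,
      real_inner_comm x p]
    ring
  have yq : ⟪q, y⟫_ℝ = 0 := by
    rw [hy, inner_sub_right, inner_sub_right, real_inner_smul_right, real_inner_smul_right, qp, qq,
      real_inner_comm x q]
    ring
  have ym : ⟪m, y⟫_ℝ = 0 := by
    rw [hy, inner_sub_right, inner_sub_right, real_inner_smul_right, real_inner_smul_right, mp, mq, mx]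
    ring
  have hy0 : y = 0 := eq_zero_of_inner_eq_zero_of_indep hind yp yq ym
  have hxdec : x = (3 * ⟪x, p⟫_ℝ) • p + ⟪x, q⟫_ℝ • q := by
    have : x - ((3 * ⟪x, p⟫_ℝ) • p + ⟪x, q⟫_ℝ • q) = 0 := by rw [← hy0, hy]; abel
    exact sub_eq_zero.1 this
  -- norms
  have xx : ⟪x, x⟫_ℝ = 1 - ⟪m, z⟫_ℝ ^ 2 := by
    rw [hx, inner_sub_left, inner_sub_right, inner_sub_right, real_inner_smul_left, real_inner_smul_right,
      real_inner_smul_left, real_inner_smul_right, zz, mm, real_inner_comm z m]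
    ring
  have xx' : ⟪x, x⟫_ℝ = 3 * ⟪x, p⟫_ℝ ^ 2 + ⟪x, q⟫_ℝ ^ 2 := by
    conv_lhs => rw [hxdec]
    simp only [inner_add_left, inner_add_right, real_inner_smul_left, real_inner_smul_right, pp, qq, pq, qp]
    ring
  rw [← xp, ← xq, ← xx, xx']

/-- **Sum of squares of the deviations**: `Σ δᵢ² = (1 − ⟪m, z⟫²)/2`. -/
theorem sum_far_deviation_sq (hm : ‖m‖ = 1) (hz : ‖z‖ = 1)
    (hu₁ : u₁ ∈ fccSlots) (hu₂ : u₂ ∈ fccSlots) (hu₃ : u₃ ∈ fccSlots)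
    (hn₁ : ⟪A u₁, m⟫_ℝ = Real.sqrt (2 / 3)) (hn₂ : ⟪A u₂, m⟫_ℝ = Real.sqrt (2 / 3))
    (hn₃ : ⟪A u₃, m⟫_ℝ = Real.sqrt (2 / 3))
    (i12 : ⟪u₁, u₂⟫_ℝ = 1 / 2) (i13 : ⟪u₁, u₃⟫_ℝ = 1 / 2) (i23 : ⟪u₂, u₃⟫_ℝ = 1 / 2) :
    (⟪A u₁, z⟫_ℝ - Real.sqrt (2 / 3) * ⟪m, z⟫_ℝ) ^ 2 + (⟪A u₂, z⟫_ℝ - Real.sqrt (2 / 3) * ⟪m, z⟫_ℝ) ^ 2 +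
        (⟪A u₃, z⟫_ℝ - Real.sqrt (2 / 3) * ⟪m, z⟫_ℝ) ^ 2 = (1 - ⟪m, z⟫_ℝ ^ 2) / 2 := by
  have hid := far_deviation_identity A hm hz hu₁ hu₂ hu₃ hn₁ hn₂ hn₃ i12 i13 i23
  have hsum := sum_far_inner A hm hu₁ hu₂ hu₃ hn₁ hn₂ hn₃ i12 i13 i23 z
  have h6 : Real.sqrt 6 = 3 * Real.sqrt (2 / 3) := by
    rw [show (6 : ℝ) = 3 ^ 2 * (2 / 3) by norm_num, Real.sqrt_mul (by norm_num), Real.sqrt_sq (by norm_num)]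
  rw [h6] at hsum
  set d₁ := ⟪A u₁, z⟫_ℝ - Real.sqrt (2 / 3) * ⟪m, z⟫_ℝ with hd₁
  set d₂ := ⟪A u₂, z⟫_ℝ - Real.sqrt (2 / 3) * ⟪m, z⟫_ℝ with hd₂
  set d₃ := ⟪A u₃, z⟫_ℝ - Real.sqrt (2 / 3) * ⟪m, z⟫_ℝ with hd₃
  have hsum0 : d₁ + d₂ + d₃ = 0 := by rw [hd₁, hd₂, hd₃]; linarith
  have hid' : 3 * d₁ ^ 2 + (d₂ - d₃) ^ 2 = 1 - ⟪m, z⟫_ℝ ^ 2 := by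
    rw [← hid, hd₂, hd₃]; ring
  linear_combination (1 / 2 : ℝ) * hid' + (1 / 2 : ℝ) * (d₂ + d₃ - d₁) * hsum0

/-- **A steep far slot.**  Some far slot has deviation at least `sin∠(m, z)/(2√3)`:
`√(1 − ⟪m, z⟫²) ≤ 2√3 · (⟪A uᵢ, z⟫ − √(2/3) ⟪m, z⟫)` for some `i`. -/
theorem exists_far_slot_steep (hm : ‖m‖ = 1) (hz : ‖z‖ = 1)
    (hu₁ : u₁ ∈ fccSlots) (hu₂ : u₂ ∈ fccSlots) (hu₃ : u₃ ∈ fccSlots)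
    (hn₁ : ⟪A u₁, m⟫_ℝ = Real.sqrt (2 / 3)) (hn₂ : ⟪A u₂, m⟫_ℝ = Real.sqrt (2 / 3))
    (hn₃ : ⟪A u₃, m⟫_ℝ = Real.sqrt (2 / 3))
    (i12 : ⟪u₁, u₂⟫_ℝ = 1 / 2) (i13 : ⟪u₁, u₃⟫_ℝ = 1 / 2) (i23 : ⟪u₂, u₃⟫_ℝ = 1 / 2) :
    ∃ u ∈ ({u₁, u₂, u₃} : Finset (EuclideanSpace ℝ (Fin 3))),
      0 ≤ ⟪A u, z⟫_ℝ - Real.sqrt (2 / 3) * ⟪m, z⟫_ℝ ∧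
      Real.sqrt (1 - ⟪m, z⟫_ℝ ^ 2) ≤ 2 * Real.sqrt 3 * (⟪A u, z⟫_ℝ - Real.sqrt (2 / 3) * ⟪m, z⟫_ℝ) := by
  have hsq := sum_far_deviation_sq A hm hz hu₁ hu₂ hu₃ hn₁ hn₂ hn₃ i12 i13 i23
  have hsum := sum_far_inner A hm hu₁ hu₂ hu₃ hn₁ hn₂ hn₃ i12 i13 i23 z
  have h6 : Real.sqrt 6 = 3 * Real.sqrt (2 / 3) := by
    rw [show (6 : ℝ) = 3 ^ 2 * (2 / 3) by norm_num, Real.sqrt_mul (by norm_num), Real.sqrt_sq (by norm_num)]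
  rw [h6] at hsum
  have h3 : Real.sqrt 3 ^ 2 = 3 := Real.sq_sqrt (by norm_num)
  have h3p : 0 ≤ Real.sqrt 3 := Real.sqrt_nonneg _
  -- the maximum `M` of three reals with sum `0` and sum of squares `S/2` has `M ≥ 0`, `12 M² ≥ S`
  have key : ∀ (S M a b : ℝ), a ≤ M → b ≤ M → M + a + b = 0 → M ^ 2 + a ^ 2 + b ^ 2 = S / 2 →
      0 ≤ M ∧ Real.sqrt S ≤ 2 * Real.sqrt 3 * M := by
    intro S M a b ha hb h0 h2
    have hM : 0 ≤ M := by linarith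
    have hab : 0 ≤ (M - a) * (M - b) := mul_nonneg (sub_nonneg.2 ha) (sub_nonneg.2 hb)
    have hM2 : S ≤ (2 * Real.sqrt 3 * M) ^ 2 := by
      have e : (2 * Real.sqrt 3 * M) ^ 2 = 12 * M ^ 2 := by rw [mul_pow, mul_pow, h3]; ring
      rw [e]; nlinarith
    have hpos : 0 ≤ 2 * Real.sqrt 3 * M := mul_nonneg (mul_nonneg (by norm_num) h3p) hM
    refine ⟨hM, ?_⟩
    calc Real.sqrt S ≤ Real.sqrt ((2 * Real.sqrt 3 * M) ^ 2) := Real.sqrt_le_sqrt hM2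
      _ = 2 * Real.sqrt 3 * M := Real.sqrt_sq hpos
  have m₁ : u₁ ∈ ({u₁, u₂, u₃} : Finset (EuclideanSpace ℝ (Fin 3))) := mem_insert_self _ _
  have m₂ : u₂ ∈ ({u₁, u₂, u₃} : Finset (EuclideanSpace ℝ (Fin 3))) :=
    mem_insert_of_mem (mem_insert_self _ _)
  have m₃ : u₃ ∈ ({u₁, u₂, u₃} : Finset (EuclideanSpace ℝ (Fin 3))) :=
    mem_insert_of_mem (mem_insert_of_mem (mem_singleton_self _))
  have e₁ : ⟪A u₁, z⟫_ℝ - Real.sqrt (2 / 3) * ⟪m, z⟫_ℝ + (⟪A u₂, z⟫_ℝ - Real.sqrt (2 / 3) * ⟪m, z⟫_ℝ) +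
      (⟪A u₃, z⟫_ℝ - Real.sqrt (2 / 3) * ⟪m, z⟫_ℝ) = 0 := by linarith
  rcases le_total (⟪A u₂, z⟫_ℝ - Real.sqrt (2 / 3) * ⟪m, z⟫_ℝ) (⟪A u₁, z⟫_ℝ - Real.sqrt (2 / 3) * ⟪m, z⟫_ℝ)
    with h21 | h12' <;>
  rcases le_total (⟪A u₃, z⟫_ℝ - Real.sqrt (2 / 3) * ⟪m, z⟫_ℝ) (⟪A u₁, z⟫_ℝ - Real.sqrt (2 / 3) * ⟪m, z⟫_ℝ)
    with h31 | h13' <;>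
  rcases le_total (⟪A u₃, z⟫_ℝ - Real.sqrt (2 / 3) * ⟪m, z⟫_ℝ) (⟪A u₂, z⟫_ℝ - Real.sqrt (2 / 3) * ⟪m, z⟫_ℝ)
    with h32 | h23'
  · exact ⟨u₁, m₁, key _ _ _ _ h21 h31 e₁ hsq⟩
  · exact ⟨u₁, m₁, key _ _ _ _ h21 h31 e₁ hsq⟩
  · exact ⟨u₁, m₁, key _ _ _ _ h21 (h32.trans h21) e₁ hsq⟩
  · exact ⟨u₃, m₃, key _ _ _ _ h13' h23' (by linarith) (by linarith)⟩
  · exact ⟨u₂, m₂, key _ _ _ _ h12' h32 (by linarith) (by linarith)⟩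
  · exact ⟨u₂, m₂, key _ _ _ _ h12' (h31.trans h12') (by linarith) (by linarith)⟩
  · exact ⟨u₂, m₂, key _ _ _ _ h12' h32 (by linarith) (by linarith)⟩
  · exact ⟨u₃, m₃, key _ _ _ _ h13' h23' (by linarith) (by linarith)⟩

/-- **Two far slots with a large spread.**  Some ordered pair of far slots has
`√3 · √(1 − ⟪m, z⟫²) ≤ 2 (δᵢ − δⱼ)`, i.e. `δ_max − δ_min ≥ (√3/2) sin∠(m, z)`. -/
theorem exists_far_slots_spread (hm : ‖m‖ = 1) (hz : ‖z‖ = 1)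
    (hu₁ : u₁ ∈ fccSlots) (hu₂ : u₂ ∈ fccSlots) (hu₃ : u₃ ∈ fccSlots)
    (hn₁ : ⟪A u₁, m⟫_ℝ = Real.sqrt (2 / 3)) (hn₂ : ⟪A u₂, m⟫_ℝ = Real.sqrt (2 / 3))
    (hn₃ : ⟪A u₃, m⟫_ℝ = Real.sqrt (2 / 3))
    (i12 : ⟪u₁, u₂⟫_ℝ = 1 / 2) (i13 : ⟪u₁, u₃⟫_ℝ = 1 / 2) (i23 : ⟪u₂, u₃⟫_ℝ = 1 / 2) :
    ∃ u ∈ ({u₁, u₂, u₃} : Finset (EuclideanSpace ℝ (Fin 3))),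
      ∃ u' ∈ ({u₁, u₂, u₃} : Finset (EuclideanSpace ℝ (Fin 3))),
      Real.sqrt 3 * Real.sqrt (1 - ⟪m, z⟫_ℝ ^ 2) ≤ 2 * (⟪A u, z⟫_ℝ - ⟪A u', z⟫_ℝ) := by
  have hsq := sum_far_deviation_sq A hm hz hu₁ hu₂ hu₃ hn₁ hn₂ hn₃ i12 i13 i23
  have hsum := sum_far_inner A hm hu₁ hu₂ hu₃ hn₁ hn₂ hn₃ i12 i13 i23 z
  have h6 : Real.sqrt 6 = 3 * Real.sqrt (2 / 3) := by
    rw [show (6 : ℝ) = 3 ^ 2 * (2 / 3) by norm_num, Real.sqrt_mul (by norm_num), Real.sqrt_sq (by norm_num)]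
  rw [h6] at hsum
  have h3 : Real.sqrt 3 ^ 2 = 3 := Real.sq_sqrt (by norm_num)
  have h3p : 0 ≤ Real.sqrt 3 := Real.sqrt_nonneg _
  -- max `M`, middle `b`, min `N` of three reals with sum `0`, sum of squares `S/2`: `(M − N)² ≥ 3S/4`
  have key : ∀ (S M b N : ℝ), b ≤ M → N ≤ b → M + b + N = 0 → M ^ 2 + b ^ 2 + N ^ 2 = S / 2 →
      Real.sqrt 3 * Real.sqrt S ≤ 2 * (M - N) := by
    intro S M b N hbM hNb h0 h2
    have hMN : 0 ≤ 2 * (M - N) := by linarith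
    have hprod : 0 ≤ (M - b) * (b - N) := mul_nonneg (sub_nonneg.2 hbM) (sub_nonneg.2 hNb)
    have hsq' : 3 * S ≤ (2 * (M - N)) ^ 2 := by nlinarith
    have : Real.sqrt (3 * S) ≤ 2 * (M - N) := by
      calc Real.sqrt (3 * S) ≤ Real.sqrt ((2 * (M - N)) ^ 2) := Real.sqrt_le_sqrt hsq'
        _ = 2 * (M - N) := Real.sqrt_sq hMN
    rwa [Real.sqrt_mul (by norm_num)] at this
  have m₁ : u₁ ∈ ({u₁, u₂, u₃} : Finset (EuclideanSpace ℝ (Fin 3))) := mem_insert_self _ _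
  have m₂ : u₂ ∈ ({u₁, u₂, u₃} : Finset (EuclideanSpace ℝ (Fin 3))) :=
    mem_insert_of_mem (mem_insert_self _ _)
  have m₃ : u₃ ∈ ({u₁, u₂, u₃} : Finset (EuclideanSpace ℝ (Fin 3))) :=
    mem_insert_of_mem (mem_insert_of_mem (mem_singleton_self _))
  have e1 : ∀ (u u' : EuclideanSpace ℝ (Fin 3)),
      2 * ((⟪A u, z⟫_ℝ - Real.sqrt (2 / 3) * ⟪m, z⟫_ℝ) - (⟪A u', z⟫_ℝ - Real.sqrt (2 / 3) * ⟪m, z⟫_ℝ)) =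
        2 * (⟪A u, z⟫_ℝ - ⟪A u', z⟫_ℝ) := by intros; ring
  rcases le_total (⟪A u₂, z⟫_ℝ - Real.sqrt (2 / 3) * ⟪m, z⟫_ℝ) (⟪A u₁, z⟫_ℝ - Real.sqrt (2 / 3) * ⟪m, z⟫_ℝ)
    with h21 | h12' <;>
  rcases le_total (⟪A u₃, z⟫_ℝ - Real.sqrt (2 / 3) * ⟪m, z⟫_ℝ) (⟪A u₁, z⟫_ℝ - Real.sqrt (2 / 3) * ⟪m, z⟫_ℝ)
    with h31 | h13' <;>
  rcases le_total (⟪A u₃, z⟫_ℝ - Real.sqrt (2 / 3) * ⟪m, z⟫_ℝ) (⟪A u₂, z⟫_ℝ - Real.sqrt (2 / 3) * ⟪m, z⟫_ℝ)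
    with h32 | h23'
  · refine ⟨u₁, m₁, u₃, m₃, ?_⟩; rw [← e1]; exact key _ _ _ _ h21 h32 (by linarith) (by linarith)
  · refine ⟨u₁, m₁, u₂, m₂, ?_⟩; rw [← e1]; exact key _ _ _ _ h31 h23' (by linarith) (by linarith)
  · refine ⟨u₃, m₃, u₂, m₂, ?_⟩; rw [← e1]; exact key _ _ _ _ h13' h21 (by linarith) (by linarith)
  · refine ⟨u₃, m₃, u₂, m₂, ?_⟩; rw [← e1]; exact key _ _ _ _ h13' h21 (by linarith) (by linarith)
  · refine ⟨u₂, m₂, u₃, m₃, ?_⟩; rw [← e1]; exact key _ _ _ _ h12' h31 (by linarith) (by linarith)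
  · refine ⟨u₂, m₂, u₃, m₃, ?_⟩; rw [← e1]; exact key _ _ _ _ h12' h31 (by linarith) (by linarith)
  · refine ⟨u₂, m₂, u₁, m₁, ?_⟩; rw [← e1]; exact key _ _ _ _ h32 h13' (by linarith) (by linarith)
  · refine ⟨u₃, m₃, u₁, m₁, ?_⟩; rw [← e1]; exact key _ _ _ _ h23' h12' (by linarith) (by linarith)

end FarFrame

end Summit.Ventures.Crystal3D.Theorems

end
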